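import Summits.QuantumFields.YangMills.Theorems.BalabanUVNodesN19TiltPathGaussian

/-!
# BalabanUVNodes ∕ node N19 (NE7 bracket) — THE ANNEALED (TILT-PATH) ROAD, GAUSSIAN CHAPTER II: the L¹ re-tilt and the two-run bound
# `|log Z_B(t) − log Z_A(t) − (log Z_B(0) − log Z_A(0))| ≤ (e^{2|t|B} − 1)·ϑ·|Tor M|∕(2γ)` for any pair of coercive quadratic actions `ϑ`-close in form

Cell `pub-ymgap`, HUMAN RULING D-0062 (Track A), R134 ACCELERATION seat `pub-ymgap-dag-n19-c` (N19 NE7, strategy s1), generation 12, module 19a-II; route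
`Summits/QuantumFields/YangMills/Theses/BalabanUVNodes.lean` rev 19 (K3⁗ `SpineGivenEndpointR13Sep` = stmt-QuantumFields-20292, `--supports … --as helper`); venue R424
(namespace `Summit.QuantumFields.YangMills.BalabanUVNodes.N19TiltPathGaussianTwoRuns`).  ADDITIVE — imports this seat's `…N19TiltPathGaussian` (19a-I: the chord algebra,
Feynman–Hellmann `hasDerivAt_integral_exp_neg_pathAction`, `continuousOn_integral_exp_neg_pathAction`, equipartition `integral_action_mul_exp_neg_action`) and through it n14-c's
`…N18KingModelLargeField` (`integrable_exp_neg_action`, `integrable_dressed`, `dressedZ_full_pos`) — CITED; THEOREMS ONLY (0 `def`), modifies nothing.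
* §4 [folklore] ★ **`abs_ratio_sub_ratio_le`** — THE L¹ RE-TILT on any measure space: a reference density `ρ ≥ 0`, a weight `g ∈ [e^{−c}, e^{c}]`, a possibly UNBOUNDED observable `f`:
  the `g`-tilted `ρ`-mean of `f` moves by at most `(e^{2c} − 1)·(∫|f|ρ)∕(∫ρ)` (the two normalised densities have ratio in `[e^{−2c}, e^{2c}]`; `e^{2c} + e^{−2c} ≥ 2`).  The
  L^∞-oscillation sibling is p510306's `abs_integral_tilted_sub_integral_le_exp_mul_osc`; a quadratic observable under a Gaussian needs this L¹ form.
* §5 [folklore ∘ 19a-I + §4] ★★★ **`abs_log_sub_log_sub_le_of_actionBound`** — `Δ_A`, `Δ_B` `γ`-coercive (`γ > 0`) with `|½φ·Δ_Aφ − ½φ·Δ_Bφ| ≤ ϑ·(φ·φ)∕2`, `W` bounded measurable,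
  `Z_X(s) = ∫ e^{−½φ·Δ_Xφ}e^{sW(φ)}dφ` on the FULL field space: `|log Z_B(t) − log Z_A(t) − (log Z_B(0) − log Z_A(0))| ≤ (e^{2|t|B} − 1)·ϑ·|Tor M|∕(2γ)`.  Road: along the chord
  (`coercive_chord`) `h(u) = log Z_u(t) − log Z_u(0)` is continuous on `[0,1]`, differentiable on `(0,1)` with `h′ = −½(E_{u,t} − E_{u,0})[φ·Dφ]` (Feynman–Hellmann), the L¹ re-tilt
  bounds `|h′|` by `½(e^{2|t|B} − 1)E_{u,0}|φ·Dφ| ≤ (e^{2|t|B} − 1)(ϑ∕2γ)E_{u,0}[φ·Δ_uφ]`, EQUIPARTITION evaluates the last mean to `|Tor M|`, and the mean value inequality on `[0,1]`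
  (Mathlib `Convex.image_sub_le_mul_sub_of_deriv_le` ∕ `mul_sub_le_image_sub_of_le_deriv`) closes.  The constant DISPLAYED is the free-energy difference; exact at `t = 0`; the DENS
  road's small-field radius `R²` is replaced by the thermal size `(e^{2|t|B} − 1)∕γ` of the field under the tilt budget; NO split, NO radius, NO numeric hypothesis.

HONEST FRAMING.  Finite-dimensional Gaussian calculus [folklore]; consumer = King's `A = 0` scalar MODEL (`…N19TiltPathKingModel`), NOT Bałaban's NE7 (NOT PRINTED; NODE O's
objects) — in the non-Gaussian procedure the action difference is NOT second-moment-small on large fields, which is exactly why NE7b exists.  Count-neutral; N18 ∕ N19 ∕ N20 ∕ N27 NOT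
discharged; counts UNMOVED.  Everything is PROVED (0 `sorry`, 0 named facts).  One finite four-torus programme at fixed ε; NOT ℝ⁴, NOT OS, NOT a mass gap, NOT Clay.
-/

noncomputable section

namespace Summit.QuantumFields.YangMills.BalabanUVNodes.N19TiltPathGaussianTwoRuns

open MeasureTheory Set Filter Real Matrix Topology
open scoped BigOperators
open Literature.MathematicalPhysics.QuantumFieldTheory.Balaban1983to89.B5Prop11Plancherel (Tor)
open Literature.MathematicalPhysics.QuantumFieldTheory.Balaban1983to89.QGQInverse (Coercive)
open YMDAG.N18.KingModelLargeField (integrable_exp_neg_action integrable_dressed dressedZ_full_pos)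
open Summit.QuantumFields.YangMills.BalabanUVNodes.N19TiltPathGaussian

variable {d : ℕ} (M : Fin d → ℕ) [hM : ∀ μ, NeZero (M μ)]

/-! ## §4 The L¹ re-tilt: a bounded weight moves a mean by at most `(e^{2c} − 1)` times the absolute first moment -/
section Retilt

variable {Ω : Type*} [MeasurableSpace Ω] {ν : Measure Ω} {ρ g f : Ω → ℝ} {c : ℝ}

/-- **★ THE L¹ RE-TILT** [folklore]: `ρ ≥ 0` a reference density with `∫ρ > 0`, `g` a weight with values in `[e^{−c}, e^{c}]`, `f` a (possibly UNBOUNDED) observable with `fρ`, `fρg`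
integrable.  Then the `g`-tilted `ρ`-mean of `f` differs from the untilted one by at most `(e^{2c} − 1)·(∫|f|ρ)∕(∫ρ)`: the ratio of the two normalised densities lies in
`[e^{−2c}, e^{2c}]`, and `e^{2c} + e^{−2c} ≥ 2`.  (The L^∞-oscillation sibling is p510306's `abs_integral_tilted_sub_integral_le_exp_mul_osc`; this L¹ form is what an unbounded
quadratic observable under a Gaussian needs.) -/
theorem abs_ratio_sub_ratio_le (hρ0 : ∀ ω, 0 ≤ ρ ω) (hg : ∀ ω, Real.exp (-c) ≤ g ω ∧ g ω ≤ Real.exp c)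
    (hρi : Integrable ρ ν) (hρgi : Integrable (fun ω => ρ ω * g ω) ν)
    (hfρi : Integrable (fun ω => f ω * ρ ω) ν) (hfρgi : Integrable (fun ω => f ω * ρ ω * g ω) ν)
    (hZ : 0 < ∫ ω, ρ ω ∂ν) :
    |(∫ ω, f ω * ρ ω * g ω ∂ν) / (∫ ω, ρ ω * g ω ∂ν) - (∫ ω, f ω * ρ ω ∂ν) / (∫ ω, ρ ω ∂ν)|
      ≤ (Real.exp (2 * c) - 1) * (∫ ω, |f ω| * ρ ω ∂ν) / ∫ ω, ρ ω ∂ν := by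
  set Z0 : ℝ := ∫ ω, ρ ω ∂ν with hZ0
  set Zg : ℝ := ∫ ω, ρ ω * g ω ∂ν with hZg
  set N0 : ℝ := ∫ ω, f ω * ρ ω ∂ν with hN0
  set Ng : ℝ := ∫ ω, f ω * ρ ω * g ω ∂ν with hNg
  have hZne : Z0 ≠ 0 := hZ.ne'
  -- `Zg ∈ [e^{−c}Z0, e^{c}Z0]`
  have hZg1 : Real.exp (-c) * Z0 ≤ Zg := by
    rw [hZ0, ← integral_const_mul]
    exact integral_mono (hρi.const_mul _) hρgi fun ω => by
      have := mul_le_mul_of_nonneg_left (hg ω).1 (hρ0 ω)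
      simp only
      linarith [mul_comm (ρ ω) (g ω)]
  have hZg2 : Zg ≤ Real.exp c * Z0 := by
    rw [hZ0, ← integral_const_mul]
    exact integral_mono hρgi (hρi.const_mul _) fun ω => by
      have := mul_le_mul_of_nonneg_left (hg ω).2 (hρ0 ω)
      simp only
      linarith [mul_comm (ρ ω) (g ω)]
  have hZgpos : 0 < Zg := lt_of_lt_of_le (mul_pos (Real.exp_pos _) hZ) hZg1
  have hZgne : Zg ≠ 0 := hZgpos.ne'
  set r : ℝ := Z0 / Zg with hr
  have hr1 : Real.exp (-c) ≤ r := by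
    rw [hr, le_div_iff₀ hZgpos]
    calc Real.exp (-c) * Zg ≤ Real.exp (-c) * (Real.exp c * Z0) := mul_le_mul_of_nonneg_left hZg2 (Real.exp_pos _).le
      _ = Z0 := by rw [← mul_assoc, ← Real.exp_add, neg_add_cancel, Real.exp_zero, one_mul]
  have hr2 : r ≤ Real.exp c := by
    rw [hr, div_le_iff₀ hZgpos]
    calc Z0 = Real.exp c * (Real.exp (-c) * Z0) := by rw [← mul_assoc, ← Real.exp_add, add_neg_cancel, Real.exp_zero, one_mul]
      _ ≤ Real.exp c * Zg := mul_le_mul_of_nonneg_left hZg1 (Real.exp_pos _).le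
  -- `e^{2c} + e^{−2c} ≥ 2`
  have hLinv : Real.exp (-c + -c) = (Real.exp (2 * c))⁻¹ := by
    rw [← Real.exp_neg]
    congr 1
    ring
  have hAMGM : 2 ≤ Real.exp (2 * c) + (Real.exp (2 * c))⁻¹ := by
    have hL : 0 < Real.exp (2 * c) := Real.exp_pos _
    have hid : Real.exp (2 * c) + (Real.exp (2 * c))⁻¹ - 2 = (Real.exp (2 * c) - 1) ^ 2 / Real.exp (2 * c) := by
      field_simp
      ring
    have : 0 ≤ Real.exp (2 * c) + (Real.exp (2 * c))⁻¹ - 2 := by rw [hid]; positivity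
    linarith
  -- pointwise `|r·g − 1| ≤ e^{2c} − 1`
  have hpt : ∀ ω, |r * g ω - 1| ≤ Real.exp (2 * c) - 1 := fun ω => by
    have hlo : Real.exp (-c) * Real.exp (-c) ≤ r * g ω :=
      mul_le_mul hr1 (hg ω).1 (Real.exp_pos _).le ((Real.exp_pos _).le.trans hr1)
    have hhi : r * g ω ≤ Real.exp c * Real.exp c :=
      mul_le_mul hr2 (hg ω).2 ((Real.exp_pos _).le.trans (hg ω).1) (Real.exp_pos c).le
    rw [← Real.exp_add, hLinv] at hlo
    rw [← Real.exp_add, show c + c = 2 * c by ring] at hhi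
    rw [abs_le]
    constructor <;> linarith
  -- the difference of the two means as ONE integral against `fρ`
  have hdiff : Ng / Zg - N0 / Z0 = (∫ ω, f ω * ρ ω * (r * g ω - 1) ∂ν) / Z0 := by
    have hsplit : ∫ ω, f ω * ρ ω * (r * g ω - 1) ∂ν = r * Ng - N0 := by
      have : (fun ω => f ω * ρ ω * (r * g ω - 1)) = fun ω => r * (f ω * ρ ω * g ω) - f ω * ρ ω := by
        funext ω
        ring
      rw [this, integral_sub (hfρgi.const_mul r) hfρi, integral_const_mul]
    rw [hsplit, hr]
    field_simp
  rw [hdiff, abs_div, abs_of_pos hZ]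
  refine div_le_div_of_nonneg_right ?_ hZ.le
  have habsi : Integrable (fun ω => |f ω| * ρ ω) ν :=
    hfρi.abs.congr (Eventually.of_forall fun ω => by simp only [abs_mul, abs_of_nonneg (hρ0 ω)])
  calc |∫ ω, f ω * ρ ω * (r * g ω - 1) ∂ν| ≤ ∫ ω, |f ω * ρ ω * (r * g ω - 1)| ∂ν := abs_integral_le_integral_abs
    _ ≤ ∫ ω, (Real.exp (2 * c) - 1) * (|f ω| * ρ ω) ∂ν := by
        refine integral_mono_of_nonneg (Eventually.of_forall fun ω => abs_nonneg _) (habsi.const_mul _)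
          (Eventually.of_forall fun ω => ?_)
        simp only
        rw [abs_mul, abs_mul, abs_of_nonneg (hρ0 ω)]
        calc |f ω| * ρ ω * |r * g ω - 1| ≤ |f ω| * ρ ω * (Real.exp (2 * c) - 1) :=
              mul_le_mul_of_nonneg_left (hpt ω) (mul_nonneg (abs_nonneg _) (hρ0 ω))
          _ = (Real.exp (2 * c) - 1) * (|f ω| * ρ ω) := by ring
    _ = (Real.exp (2 * c) - 1) * ∫ ω, |f ω| * ρ ω ∂ν := integral_const_mul _ _

end Retilt

/-! ## §5 The annealed two-run bound for a pair of coercive quadratic actions -/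
section TwoRuns

/-- **★★★ THE ANNEALED TWO-RUN BOUND (GAUSSIAN TILT-PATH ROAD)** [folklore ∘ §1–§4].  `Δ_A`, `Δ_B` real matrices on `Tor M`, both `γ`-coercive (`γ > 0`), with
`|½φ·Δ_Aφ − ½φ·Δ_Bφ| ≤ ϑ·(φ·φ)∕2` (`ϑ ≥ 0`; at King's operators this is `abs_action_sub_le_torus` with `ϑ = θ_k·a`); `W` bounded measurable (`|W| ≤ B`); dressed partition functions
`Z_X(s) = ∫ e^{−½φ·Δ_Xφ}·e^{sW(φ)} dφ` on the FULL field space.  Then for every source `t`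
`|log Z_B(t) − log Z_A(t) − (log Z_B(0) − log Z_A(0))| ≤ (e^{2|t|B} − 1)·ϑ·|Tor M|∕(2γ)`.
Road: along the chord `Δ_u = Δ_A + u(Δ_B − Δ_A)` (`coercive_chord`), `h(u) = log Z_u(t) − log Z_u(0)` is continuous on `[0,1]` and differentiable on `(0,1)` (§2) with
`h′(u) = −½(E_{u,t} − E_{u,0})[φ·Dφ]`; the L¹ re-tilt (§4, weight `e^{tW} ∈ [e^{−|t|B}, e^{|t|B}]`) bounds it by `½(e^{2|t|B} − 1)·E_{u,0}|φ·Dφ| ≤ (e^{2|t|B} − 1)·(ϑ∕2γ)·E_{u,0}[φ·Δ_uφ]`,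
and EQUIPARTITION (§3) evaluates the last mean to `|Tor M|`; the mean value inequality on `[0,1]` closes.  NO small-field∕large-field split, NO radius, NO numeric hypothesis. -/
theorem abs_log_sub_log_sub_le_of_actionBound {ΔA ΔB : Matrix (Tor M) (Tor M) ℝ} {γ ϑ B : ℝ} (hγ : 0 < γ) (hϑ : 0 ≤ ϑ)
    (hcA : Coercive ΔA γ) (hcB : Coercive ΔB γ)
    (hAB : ∀ φ : Tor M → ℝ, |φ ⬝ᵥ (ΔA *ᵥ φ) / 2 - φ ⬝ᵥ (ΔB *ᵥ φ) / 2| ≤ ϑ * (φ ⬝ᵥ φ) / 2)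
    {W : (Tor M → ℝ) → ℝ} (hWm : Measurable W) (hWb : ∀ φ, |W φ| ≤ B) (t : ℝ) :
    |Real.log (∫ φ : Tor M → ℝ, Real.exp (-(φ ⬝ᵥ (ΔB *ᵥ φ) / 2)) * Real.exp (t * W φ))
        - Real.log (∫ φ : Tor M → ℝ, Real.exp (-(φ ⬝ᵥ (ΔA *ᵥ φ) / 2)) * Real.exp (t * W φ))
        - (Real.log (∫ φ : Tor M → ℝ, Real.exp (-(φ ⬝ᵥ (ΔB *ᵥ φ) / 2)) * Real.exp (0 * W φ))
            - Real.log (∫ φ : Tor M → ℝ, Real.exp (-(φ ⬝ᵥ (ΔA *ᵥ φ) / 2)) * Real.exp (0 * W φ)))|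
      ≤ (Real.exp (2 * (|t| * B)) - 1) * ϑ * Fintype.card (Tor M) / (2 * γ) := by
  -- the chord and its data
  set D : Matrix (Tor M) (Tor M) ℝ := ΔB - ΔA with hD
  have hco : ∀ u ∈ Set.Icc (0 : ℝ) 1, Coercive (ΔA + u • D) γ := fun u hu => coercive_chord M hcA hcB hu.1 hu.2
  have hq : ∀ φ : Tor M → ℝ, |φ ⬝ᵥ (D *ᵥ φ)| ≤ ϑ * (φ ⬝ᵥ φ) := fun φ => by
    rw [hD, dotProduct_sub_mulVec M]
    have h := hAB φ
    rw [← sub_div, abs_div, abs_two] at h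
    rw [abs_sub_comm]
    linarith
  have hgm : ∀ s : ℝ, Measurable fun φ : Tor M → ℝ => Real.exp (s * W φ) := fun s => Real.measurable_exp.comp (hWm.const_mul s)
  have hgb : ∀ (s : ℝ) (φ : Tor M → ℝ), |Real.exp (s * W φ)| ≤ Real.exp (|s| * B) := fun s φ => by
    rw [Real.abs_exp]
    exact (exp_mul_mem hWb s φ).2
  -- the path partition function, its derivative numerator, positivity, derivative, continuity
  set Z : ℝ → ℝ → ℝ := fun u s => ∫ φ : Tor M → ℝ, Real.exp (-(φ ⬝ᵥ ((ΔA + u • D) *ᵥ φ) / 2)) * Real.exp (s * W φ) with hZ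
  set N : ℝ → ℝ → ℝ := fun u s =>
    ∫ φ : Tor M → ℝ, -(φ ⬝ᵥ (D *ᵥ φ) / 2) * Real.exp (-(φ ⬝ᵥ ((ΔA + u • D) *ᵥ φ) / 2)) * Real.exp (s * W φ) with hN
  have hZpos : ∀ u ∈ Set.Icc (0 : ℝ) 1, ∀ s : ℝ, 0 < Z u s := fun u hu s => dressedZ_full_pos M hγ (hco u hu) hWm hWb s
  have hderivZ : ∀ u ∈ Set.Ioo (0 : ℝ) 1, ∀ s : ℝ, HasDerivAt (fun v => Z v s) (N u s) u := fun u hu s =>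
    hasDerivAt_integral_exp_neg_pathAction M hγ hϑ (Ioo_mem_nhds hu.1 hu.2) (fun v hv => hco v (Set.Ioo_subset_Icc_self hv)) hq (hgm s) (hgb s)
  have hcontZ : ∀ s : ℝ, ContinuousOn (fun v => Z v s) (Set.Icc (0 : ℝ) 1) := fun s =>
    continuousOn_integral_exp_neg_pathAction M hγ hco (hgm s) (hgb s)
  -- the path function `h(u) = log Z_u(t) − log Z_u(0)`
  have hderiv : ∀ u ∈ Set.Ioo (0 : ℝ) 1,
      HasDerivAt (fun v => Real.log (Z v t) - Real.log (Z v 0)) (N u t / Z u t - N u 0 / Z u 0) u := fun u hu =>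
    ((hderivZ u hu t).log (hZpos u (Set.Ioo_subset_Icc_self hu) t).ne').sub
      ((hderivZ u hu 0).log (hZpos u (Set.Ioo_subset_Icc_self hu) 0).ne')
  have hcont : ContinuousOn (fun v => Real.log (Z v t) - Real.log (Z v 0)) (Set.Icc (0 : ℝ) 1) :=
    ((hcontZ t).log fun v hv => (hZpos v hv t).ne').sub ((hcontZ 0).log fun v hv => (hZpos v hv 0).ne')
  -- the DRIFT bound on the open chord
  set C : ℝ := (Real.exp (2 * (|t| * B)) - 1) * ϑ * Fintype.card (Tor M) / (2 * γ) with hC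
  have hbound : ∀ u ∈ Set.Ioo (0 : ℝ) 1, |N u t / Z u t - N u 0 / Z u 0| ≤ C := by
    intro u hu
    have hu' : u ∈ Set.Icc (0 : ℝ) 1 := Set.Ioo_subset_Icc_self hu
    have hcu : Coercive (ΔA + u • D) γ := hco u hu'
    -- the untilted (`s = 0`) objects
    have hZ0 : Z u 0 = ∫ φ : Tor M → ℝ, Real.exp (-(φ ⬝ᵥ ((ΔA + u • D) *ᵥ φ) / 2)) := by
      simp only [hZ, zero_mul, Real.exp_zero, mul_one]
    have hN0 : N u 0 = ∫ φ : Tor M → ℝ, -(φ ⬝ᵥ (D *ᵥ φ) / 2) * Real.exp (-(φ ⬝ᵥ ((ΔA + u • D) *ᵥ φ) / 2)) := by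
      simp only [hN, zero_mul, Real.exp_zero, mul_one]
    have hZ0pos : 0 < ∫ φ : Tor M → ℝ, Real.exp (-(φ ⬝ᵥ ((ΔA + u • D) *ᵥ φ) / 2)) := by rw [← hZ0]; exact hZpos u hu' 0
    -- integrability
    have hρi := integrable_exp_neg_action M hγ hcu
    have hρgi := integrable_dressed M hγ hcu hWm hWb t
    have hfρgi := integrable_deriv_integrand M hγ hϑ hcu hq (hgm t) (hgb t)
    have hfρi : Integrable (fun φ : Tor M → ℝ => -(φ ⬝ᵥ (D *ᵥ φ) / 2) * Real.exp (-(φ ⬝ᵥ ((ΔA + u • D) *ᵥ φ) / 2))) :=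
      (integrable_deriv_integrand M hγ hϑ hcu hq (g := fun _ => (1 : ℝ)) measurable_const (fun _ => le_of_eq abs_one)).congr
        (Eventually.of_forall fun φ => mul_one _)
    -- the L¹ re-tilt
    have key := abs_ratio_sub_ratio_le (ν := (volume : Measure (Tor M → ℝ)))
      (ρ := fun φ => Real.exp (-(φ ⬝ᵥ ((ΔA + u • D) *ᵥ φ) / 2))) (g := fun φ => Real.exp (t * W φ))
      (f := fun φ => -(φ ⬝ᵥ (D *ᵥ φ) / 2)) (c := |t| * B)
      (fun φ => (Real.exp_pos _).le) (fun φ => exp_mul_mem hWb t φ) hρi hρgi hfρi hfρgi hZ0pos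
    -- the absolute first moment: `∫ ½|φ·Dφ|ρ ≤ (ϑ/2γ)·∫ (φ·Δ_uφ)ρ = (ϑ/2γ)·|Tor M|·∫ρ`
    have hκu : 0 ≤ ∑ x, ∑ y, |(ΔA + u • D) x y| := Finset.sum_nonneg fun x _ => Finset.sum_nonneg fun y _ => abs_nonneg _
    have hSρi : Integrable (fun φ : Tor M → ℝ => φ ⬝ᵥ ((ΔA + u • D) *ᵥ φ) * Real.exp (-(φ ⬝ᵥ ((ΔA + u • D) *ᵥ φ) / 2))) := by
      have h := integrable_deriv_integrand M hγ hκu hcu (abs_dotProduct_mulVec_le M (ΔA + u • D)) (g := fun _ => (1 : ℝ))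
        measurable_const (fun _ => le_of_eq abs_one)
      refine (h.const_mul (-2)).congr (Eventually.of_forall fun φ => ?_)
      simp only
      ring
    have hI : ∫ φ : Tor M → ℝ, |-(φ ⬝ᵥ (D *ᵥ φ) / 2)| * Real.exp (-(φ ⬝ᵥ ((ΔA + u • D) *ᵥ φ) / 2))
        ≤ ϑ / (2 * γ) * (Fintype.card (Tor M) * ∫ φ : Tor M → ℝ, Real.exp (-(φ ⬝ᵥ ((ΔA + u • D) *ᵥ φ) / 2))) := by
      rw [← integral_action_mul_exp_neg_action M hγ hcu, ← integral_const_mul]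
      refine integral_mono_of_nonneg (Eventually.of_forall fun φ => mul_nonneg (abs_nonneg _) (Real.exp_pos _).le)
        (hSρi.const_mul _) (Eventually.of_forall fun φ => ?_)
      have hρ0 : 0 ≤ Real.exp (-(φ ⬝ᵥ ((ΔA + u • D) *ᵥ φ) / 2)) := (Real.exp_pos _).le
      have hφS : φ ⬝ᵥ φ ≤ φ ⬝ᵥ ((ΔA + u • D) *ᵥ φ) / γ := by
        rw [le_div_iff₀ hγ]
        linarith [hcu φ]
      simp only
      rw [abs_neg, abs_div, abs_two]
      calc |φ ⬝ᵥ (D *ᵥ φ)| / 2 * Real.exp (-(φ ⬝ᵥ ((ΔA + u • D) *ᵥ φ) / 2))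
          ≤ ϑ * (φ ⬝ᵥ φ) / 2 * Real.exp (-(φ ⬝ᵥ ((ΔA + u • D) *ᵥ φ) / 2)) :=
            mul_le_mul_of_nonneg_right (div_le_div_of_nonneg_right (hq φ) two_pos.le) hρ0
        _ ≤ ϑ * (φ ⬝ᵥ ((ΔA + u • D) *ᵥ φ) / γ) / 2 * Real.exp (-(φ ⬝ᵥ ((ΔA + u • D) *ᵥ φ) / 2)) := by gcongr
        _ = ϑ / (2 * γ) * (φ ⬝ᵥ ((ΔA + u • D) *ᵥ φ) * Real.exp (-(φ ⬝ᵥ ((ΔA + u • D) *ᵥ φ) / 2))) := by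
            field_simp
    have hE : 0 ≤ Real.exp (2 * (|t| * B)) - 1 := by
      have hB : 0 ≤ B := (abs_nonneg _).trans (hWb fun _ => 0)
      linarith [Real.one_le_exp (by positivity : 0 ≤ 2 * (|t| * B))]
    rw [hZ0, hN0]
    calc |(∫ φ : Tor M → ℝ, -(φ ⬝ᵥ (D *ᵥ φ) / 2) * Real.exp (-(φ ⬝ᵥ ((ΔA + u • D) *ᵥ φ) / 2)) * Real.exp (t * W φ)) / Z u t
            - (∫ φ : Tor M → ℝ, -(φ ⬝ᵥ (D *ᵥ φ) / 2) * Real.exp (-(φ ⬝ᵥ ((ΔA + u • D) *ᵥ φ) / 2)))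
              / ∫ φ : Tor M → ℝ, Real.exp (-(φ ⬝ᵥ ((ΔA + u • D) *ᵥ φ) / 2))|
        ≤ (Real.exp (2 * (|t| * B)) - 1) * (∫ φ : Tor M → ℝ, |-(φ ⬝ᵥ (D *ᵥ φ) / 2)| * Real.exp (-(φ ⬝ᵥ ((ΔA + u • D) *ᵥ φ) / 2)))
            / ∫ φ : Tor M → ℝ, Real.exp (-(φ ⬝ᵥ ((ΔA + u • D) *ᵥ φ) / 2)) := key
      _ ≤ (Real.exp (2 * (|t| * B)) - 1) * (ϑ / (2 * γ) * (Fintype.card (Tor M) * ∫ φ : Tor M → ℝ, Real.exp (-(φ ⬝ᵥ ((ΔA + u • D) *ᵥ φ) / 2))))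
            / ∫ φ : Tor M → ℝ, Real.exp (-(φ ⬝ᵥ ((ΔA + u • D) *ᵥ φ) / 2)) := by gcongr
      _ = C := by
          rw [hC]
          field_simp
  -- the mean value inequality on `[0,1]`
  have hdiffOn : DifferentiableOn ℝ (fun v => Real.log (Z v t) - Real.log (Z v 0)) (interior (Set.Icc (0 : ℝ) 1)) := by
    rw [interior_Icc]
    exact fun u hu => (hderiv u hu).differentiableAt.differentiableWithinAt
  have hle : ∀ u ∈ interior (Set.Icc (0 : ℝ) 1), deriv (fun v => Real.log (Z v t) - Real.log (Z v 0)) u ≤ C := by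
    rw [interior_Icc]
    exact fun u hu => by rw [(hderiv u hu).deriv]; exact (abs_le.1 (hbound u hu)).2
  have hge : ∀ u ∈ interior (Set.Icc (0 : ℝ) 1), -C ≤ deriv (fun v => Real.log (Z v t) - Real.log (Z v 0)) u := by
    rw [interior_Icc]
    exact fun u hu => by rw [(hderiv u hu).deriv]; exact (abs_le.1 (hbound u hu)).1
  have h0 : (0 : ℝ) ∈ Set.Icc (0 : ℝ) 1 := ⟨le_rfl, zero_le_one⟩
  have h1 : (1 : ℝ) ∈ Set.Icc (0 : ℝ) 1 := ⟨zero_le_one, le_rfl⟩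
  have hup := (convex_Icc (0 : ℝ) 1).image_sub_le_mul_sub_of_deriv_le hcont hdiffOn hle 0 h0 1 h1 zero_le_one
  have hdn := (convex_Icc (0 : ℝ) 1).mul_sub_le_image_sub_of_le_deriv hcont hdiffOn hge 0 h0 1 h1 zero_le_one
  -- the endpoints ARE the two runs
  have hZ1 : ∀ s : ℝ, Z 1 s = ∫ φ : Tor M → ℝ, Real.exp (-(φ ⬝ᵥ (ΔB *ᵥ φ) / 2)) * Real.exp (s * W φ) := fun s => by
    simp only [hZ, hD, one_smul, add_sub_cancel]
  have hZ0' : ∀ s : ℝ, Z 0 s = ∫ φ : Tor M → ℝ, Real.exp (-(φ ⬝ᵥ (ΔA *ᵥ φ) / 2)) * Real.exp (s * W φ) := fun s => by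
    simp only [hZ, zero_smul, add_zero]
  simp only [hZ1, hZ0', sub_zero, mul_one] at hup hdn
  rw [abs_le]
  constructor <;> linarith

end TwoRuns

end Summit.QuantumFields.YangMills.BalabanUVNodes.N19TiltPathGaussianTwoRuns

end
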